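import Literature.NumberTheory.GelbartRogawski1991.LocalKudlaSplittingRigidity
import Literature.RepresentationTheory.MoeglinVignerasWaldspurger1987.RankOneThetaLiftLinesEquivalent
import HarnessLib

/-!
# Conjugation by the line isometry at the doubled level: the `P_Δ`-normalisation is preserved, hence the conjugate of
# one normalised splitting IS the other

Topic `NumberTheory/GelbartRogawski1991`; namespace `Literature.NumberTheory.GelbartRogawski1991.UnitaryDualPair.LocalSplitting`.
KERNEL ONLY: theorems; no definition, no named fact, no `sorry`.  Cell hodgecm-mathlib, line a4-liuD3 (`stub_iso_of_params`,
step S6a «the `μ`-splitting is natural under the local isometry of two skew-hermitian lines of the same class»), doubled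
level, δ-MODEL: ONE doubled group `H = U(J ⊕ −J)(F_v)` and ONE metaplectic group `S̃p_ψ(𝕎^𝔻_v)` of the doubled Gram matrix
`gramD n T₀`, two trace-zero elements `δ₁, δ₂` with `δ₂ = x xᶜ δ₁` in `E ⊗ F_v`, the two embeddings `ι^𝔻_{δ₁}, ι^𝔻_{δ₂}`
conjugate by the transport `γ_x ∈ Sp(𝕎^𝔻_v)` of [MoeglinVignerasWaldspurger1987, Chap. 3 I.1–I.3]
(`LineTransport.iota_eq_conj_iota`, `RankOneThetaLiftLinesEquivalent.lean`, any rank), and a lift `P` of `γ_x`: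

* §1 `parabolic_toRep_conj_conj` — if a section `Σ` over `ι^𝔻_{δ₁}` satisfies the parabolic normalisation in operator form
  (`(ω(m Σ(p) m⁻¹) Φ)(0) = c(p) Φ(0)` for all movers `m` of `ℓ_Δ` onto `ℓ_Y` and all `p ∈ P_Δ`, `LocalKudlaSplittingRigidity`),
  then so does its conjugate `P Σ P⁻¹` for ANY `P` whose projection preserves `ℓ_Δ` (`m (P Σ(p) P⁻¹) m⁻¹ = (mP) Σ(p) (mP)⁻¹`
  and `mP` is again a mover; `P_Δ` does not depend on `δ`, `isSiegelDelta_iff_of_delta`);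
* §2 **`conj_comp_eq_of_parabolic`** — hence, by the rigidity `eq_of_parabolic_toRep_conj_eq`: if `S₁` (over `ι^𝔻_{δ₁}`) and
  `S₂` (over `ι^𝔻_{δ₂}`) are both normalised with the same scalar `c` (non-vanishing on `P_Δ`), every character of `H(F_v)`
  trivial on `P_Δ` is trivial, some mover exists, and `π(P) = γ_x` preserves `ℓ_Δ`, then **`P S₁ P⁻¹ = S₂`**.
  The undoubled consequence (S6a) follows with «undoubling commutes with conjugation» (`LocalLineIsometryUndoubling`, B-p02)
  and «undoubling commutes with the scale transport» (`LocalScaleModelTransportUndoubling`).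

References: [GelbartRogawski1991] §3.1 Prop. 3.1.1 p. 455, Remark p. 457 L4–13; [Kudla1994] §3 Thm. 3.1;
[MoeglinVignerasWaldspurger1987] Chap. 2 II.1, Chap. 3 I.1–I.3; [HarrisKudlaSweet1996] §1 (1.11)–(1.16); [Liu2021] App. D §D.1.
-/

set_option autoImplicit false

noncomputable section

open NumberField IsDedekindDomain Matrix
open Literature.RepresentationTheory.HeisenbergGroup
open Literature.RepresentationTheory.MoeglinVignerasWaldspurger1987
open Literature.NumberTheory.Automorphic Literature.NumberTheory.Automorphic.UnitaryGroup Literature.NumberTheory.Weil1964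

namespace Literature.NumberTheory.GelbartRogawski1991.UnitaryDualPair.LocalSplitting

variable (F : Type) [Field F] [NumberField F] (E : Type) [Field E] [NumberField E] [Algebra F E]
  [Algebra.IsQuadraticExtension F E] (c : E ≃ₐ[F] E) (v : HeightOneSpectrum (𝓞 F)) (n : ℕ)
  {T₀ : Matrix (Fin n) (Fin n) F} {JD : Matrix (Fin (n + n)) (Fin (n + n)) E}
  {δ₁ : E} (hcδ₁ : c δ₁ = -δ₁) (hδ₁ : δ₁ ≠ 0) {d₁ : F} (hd₁ : δ₁ * δ₁ = algebraMap F E d₁)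
  {δ₂ : E} (hcδ₂ : c δ₂ = -δ₂) (hδ₂ : δ₂ ≠ 0) {d₂ : F} (hd₂ : δ₂ * δ₂ = algebraMap F E d₂)

/-! ## §1 Conjugation by a `ℓ_Δ`-preserving element preserves the parabolic normalisation -/

omit [Algebra.IsQuadraticExtension F E] in
/-- the projection of a product, as a linear map, is the composite. [cite: MoeglinVignerasWaldspurger1987, Chap. 2 II.1 (B)] -/
theorem toLin_proj_mul {N : ℕ} {T : Matrix (Fin N) (Fin N) F} (m P : LocalMp F N T v) :
    toLin F v (MpPsi.proj _ (m * P)) = (toLin F v (MpPsi.proj _ m)).comp (toLin F v (MpPsi.proj _ P)) := by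
  rw [map_mul]; rfl

/-- **conjugation by `P` with `π(P) ℓ_Δ = ℓ_Δ` preserves the parabolic normalisation** (operator form, all movers; the
Siegel parabolic read for any trace-zero element on either side): `m (P Σ(p) P⁻¹) m⁻¹ = (mP) Σ(p) (mP)⁻¹`, `mP` a mover.
[cite: Kudla1994, Thm 3.1] [cite: HarrisKudlaSweet1996, §1 (1.16)] -/
theorem parabolic_toRep_conj_conj (hT₀ : T₀.IsSymm) (hJD : JD = (gramD F n T₀).map (algebraMap F E))
    (S : UnitaryGroup.localPi E c (n + n) JD v →* LocalMp F (n + n) (gramD F n T₀) v)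
    (cΔ : UnitaryGroup.localPi E c (n + n) JD v → ℂ)
    (hS : ∀ m : LocalMp F (n + n) (gramD F n T₀) v,
      (deltaLagrangian F v n).map (toLin F v (MpPsi.proj _ m)) = lagrangianY F (n + n) v →
      ∀ p, IsSiegelDelta F E c hcδ₁ hδ₁ hd₁ v n hT₀ hJD p → ∀ Φ : SchwartzBruhat (Fin (n + n) → v.adicCompletion F),
        ((MpPsi.toRep (localSchrodinger F (n + n) (gramD F n T₀) v) (m * S p * m⁻¹) Φ : SchwartzBruhat (Fin (n + n) → v.adicCompletion F)) :
          (Fin (n + n) → v.adicCompletion F) → ℂ) 0 = cΔ p * (Φ : (Fin (n + n) → v.adicCompletion F) → ℂ) 0)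
    (P : LocalMp F (n + n) (gramD F n T₀) v)
    (hP : (deltaLagrangian F v n).map (toLin F v (MpPsi.proj _ P)) = deltaLagrangian F v n)
    (m : LocalMp F (n + n) (gramD F n T₀) v)
    (hm : (deltaLagrangian F v n).map (toLin F v (MpPsi.proj _ m)) = lagrangianY F (n + n) v)
    (p : UnitaryGroup.localPi E c (n + n) JD v) (hp : IsSiegelDelta F E c hcδ₂ hδ₂ hd₂ v n hT₀ hJD p)
    (Φ : SchwartzBruhat (Fin (n + n) → v.adicCompletion F)) :
    ((MpPsi.toRep (localSchrodinger F (n + n) (gramD F n T₀) v) (m * (P * S p * P⁻¹) * m⁻¹) Φ :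
        SchwartzBruhat (Fin (n + n) → v.adicCompletion F)) :
        (Fin (n + n) → v.adicCompletion F) → ℂ) 0 = cΔ p * (Φ : (Fin (n + n) → v.adicCompletion F) → ℂ) 0 := by
  have hmP : (deltaLagrangian F v n).map (toLin F v (MpPsi.proj _ (m * P))) = lagrangianY F (n + n) v := by
    rw [toLin_proj_mul, Submodule.map_comp, hP, hm]
  have hp₁ : IsSiegelDelta F E c hcδ₁ hδ₁ hd₁ v n hT₀ hJD p :=
    (isSiegelDelta_iff_of_delta F E c hcδ₁ hδ₁ hd₁ v n hcδ₂ hδ₂ hd₂ hT₀ hT₀ hJD hJD p).1 hp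
  have hconj : m * (P * S p * P⁻¹) * m⁻¹ = m * P * S p * (m * P)⁻¹ := by
    simp only [mul_assoc, _root_.mul_inv_rev]
  rw [hconj]
  exact hS (m * P) hmP p hp₁ Φ

/-! ## §2 The conjugate of one normalised splitting by a lift of the line isometry IS the other -/

/-- the conjugate `P S₁ P⁻¹` lies over `ι^𝔻_{δ₂}` when `S₁` lies over `ι^𝔻_{δ₁}` and `π(P) = γ_x`
(`ι_{δ₂} = γ_x ι_{δ₁} γ_x⁻¹`). [cite: MoeglinVignerasWaldspurger1987, Chap. 3 I.1–I.3] -/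
theorem proj_conj_comp_eq_iota (hT₀ : T₀.IsSymm) (hJD : JD = (gramD F n T₀).map (algebraMap F E))
    (x : (LocalRing E v)ˣ)
    (hx : algebraMap E (LocalRing E v) δ₂ = (x : LocalRing E v) * conjLocal E c v x * algebraMap E (LocalRing E v) δ₁)
    (S₁ : UnitaryGroup.localPi E c (n + n) JD v →* LocalMp F (n + n) (gramD F n T₀) v)
    (hS₁ : ∀ h, MpPsi.proj _ (S₁ h) = iota F E c (n + n) hcδ₁ hδ₁ hd₁ (gramD F n T₀) (gramD_isSymm F n hT₀) hJD v h)
    (P : LocalMp F (n + n) (gramD F n T₀) v)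
    (hPproj : MpPsi.proj _ P =
      LineTransport.transportSp E v c (n + n) hcδ₁ hδ₁ hd₁ hcδ₂ hδ₂ hd₂ x (gramD F n T₀) (gramD_isSymm F n hT₀) hx)
    (h : UnitaryGroup.localPi E c (n + n) JD v) :
    MpPsi.proj _ (((MulAut.conj P).toMonoidHom.comp S₁) h) =
      iota F E c (n + n) hcδ₂ hδ₂ hd₂ (gramD F n T₀) (gramD_isSymm F n hT₀) hJD v h := by
  rw [MpPsi.proj_conj_comp_apply, hPproj, hS₁]
  exact (LineTransport.iota_eq_conj_iota E v c (n + n) hcδ₁ hδ₁ hd₁ hcδ₂ hδ₂ hd₂ x (gramD F n T₀) (gramD_isSymm F n hT₀) hJD hx h).symm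

/-- **THE CONJUGATE OF ONE `P_Δ`-NORMALISED SPLITTING BY A LIFT OF THE LINE ISOMETRY IS THE OTHER.**  `H = U(J ⊕ −J)(F_v)`,
`δ₂ = x xᶜ δ₁` in `E ⊗ F_v`; `S₁` over `ι^𝔻_{δ₁}` and `S₂` over `ι^𝔻_{δ₂}` both satisfy the parabolic normalisation in
operator form with the same scalar `c` (non-vanishing on `P_Δ`) for all movers of `ℓ_Δ` onto `ℓ_Y`; some mover `m₀` exists;
every character of `H(F_v)` trivial on `P_Δ(F_v)` is trivial; `P` lifts `γ_x` and `γ_x ℓ_Δ = ℓ_Δ`.  Then `P S₁ P⁻¹ = S₂`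
(`parabolic_toRep_conj_conj` + the rigidity `eq_of_parabolic_toRep_conj_eq`).
[cite: GelbartRogawski1991, §3.1 Remark p. 457 L4–13] [cite: Kudla1994, Thm 3.1] [cite: MoeglinVignerasWaldspurger1987, Chap. 3 I.1–I.3] -/
theorem conj_comp_eq_of_parabolic (hT₀ : T₀.IsSymm) (hT₀d : IsUnit T₀.det)
    (hJD : JD = (gramD F n T₀).map (algebraMap F E)) (x : (LocalRing E v)ˣ)
    (hx : algebraMap E (LocalRing E v) δ₂ = (x : LocalRing E v) * conjLocal E c v x * algebraMap E (LocalRing E v) δ₁)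
    (S₁ S₂ : UnitaryGroup.localPi E c (n + n) JD v →* LocalMp F (n + n) (gramD F n T₀) v)
    (hS₁ : ∀ h, MpPsi.proj _ (S₁ h) = iota F E c (n + n) hcδ₁ hδ₁ hd₁ (gramD F n T₀) (gramD_isSymm F n hT₀) hJD v h)
    (hS₂ : ∀ h, MpPsi.proj _ (S₂ h) = iota F E c (n + n) hcδ₂ hδ₂ hd₂ (gramD F n T₀) (gramD_isSymm F n hT₀) hJD v h)
    (cΔ : UnitaryGroup.localPi E c (n + n) JD v → ℂ) (hc : ∀ p, IsSiegelDelta F E c hcδ₂ hδ₂ hd₂ v n hT₀ hJD p → cΔ p ≠ 0)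
    (hS₁Δ : ∀ m : LocalMp F (n + n) (gramD F n T₀) v,
      (deltaLagrangian F v n).map (toLin F v (MpPsi.proj _ m)) = lagrangianY F (n + n) v →
      ∀ p, IsSiegelDelta F E c hcδ₁ hδ₁ hd₁ v n hT₀ hJD p → ∀ Φ : SchwartzBruhat (Fin (n + n) → v.adicCompletion F),
        ((MpPsi.toRep (localSchrodinger F (n + n) (gramD F n T₀) v) (m * S₁ p * m⁻¹) Φ : SchwartzBruhat (Fin (n + n) → v.adicCompletion F)) :
          (Fin (n + n) → v.adicCompletion F) → ℂ) 0 = cΔ p * (Φ : (Fin (n + n) → v.adicCompletion F) → ℂ) 0)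
    (hS₂Δ : ∀ m : LocalMp F (n + n) (gramD F n T₀) v,
      (deltaLagrangian F v n).map (toLin F v (MpPsi.proj _ m)) = lagrangianY F (n + n) v →
      ∀ p, IsSiegelDelta F E c hcδ₂ hδ₂ hd₂ v n hT₀ hJD p → ∀ Φ : SchwartzBruhat (Fin (n + n) → v.adicCompletion F),
        ((MpPsi.toRep (localSchrodinger F (n + n) (gramD F n T₀) v) (m * S₂ p * m⁻¹) Φ : SchwartzBruhat (Fin (n + n) → v.adicCompletion F)) :
          (Fin (n + n) → v.adicCompletion F) → ℂ) 0 = cΔ p * (Φ : (Fin (n + n) → v.adicCompletion F) → ℂ) 0)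
    (hκ : ∀ θ : UnitaryGroup.localPi E c (n + n) JD v →* ℂˣ,
      (∀ p, IsSiegelDelta F E c hcδ₂ hδ₂ hd₂ v n hT₀ hJD p → θ p = 1) → θ = 1)
    (P : LocalMp F (n + n) (gramD F n T₀) v)
    (hPproj : MpPsi.proj _ P =
      LineTransport.transportSp E v c (n + n) hcδ₁ hδ₁ hd₁ hcδ₂ hδ₂ hd₂ x (gramD F n T₀) (gramD_isSymm F n hT₀) hx)
    (hP : (deltaLagrangian F v n).map (toLin F v (MpPsi.proj _ P)) = deltaLagrangian F v n)
    (m₀ : LocalMp F (n + n) (gramD F n T₀) v)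
    (hm₀ : (deltaLagrangian F v n).map (toLin F v (MpPsi.proj _ m₀)) = lagrangianY F (n + n) v) :
    (MulAut.conj P).toMonoidHom.comp S₁ = S₂ :=
  eq_of_parabolic_toRep_conj_eq F E c hcδ₂ hδ₂ hd₂ v n hT₀ hT₀d hJD S₂ ((MulAut.conj P).toMonoidHom.comp S₁)
    (fun g => by
      rw [proj_conj_comp_eq_iota F E c v n hcδ₁ hδ₁ hd₁ hcδ₂ hδ₂ hd₂ hT₀ hJD x hx S₁ hS₁ P hPproj g, hS₂])
    hκ cΔ hc m₀ (hS₂Δ m₀ hm₀)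
    (fun p hp Φ => parabolic_toRep_conj_conj F E c v n hcδ₁ hδ₁ hd₁ hcδ₂ hδ₂ hd₂ hT₀ hJD S₁ cΔ hS₁Δ P hP m₀ hm₀ p hp Φ)

end Literature.NumberTheory.GelbartRogawski1991.UnitaryDualPair.LocalSplitting

end
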